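import Summits.NavierStokesRegularity.NavierStokesRegularity.Theses.SymmetryModuliCount
import Summits.NavierStokesRegularity.NavierStokesRegularity.Theorems.SymmetricLiouville.Negative.LoadBearing
import Literature.Analysis.FluidPDE.PineauVicolRSS
import Literature.Analysis.FluidPDE.SwirlTransportProofs

/-!
# Line `spiral-weight-killing-pairing` — skeleton for crux `SymmetryModuliCount.SymmetricLiouville`
# (stmt-NavierStokesRegularity-4053, route-NavierStokesRegularity-SymmetryModuliCount, rank 3)

See `Lines/spiral-weight-killing-pairing.md` (the line card) for the prose: idea, stubs, hardest
stub, barriers, Disproof used, triage answers.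

THE CRUX ("continuous symmetry is free"). Every `u ∈ 𝒜_C` — smooth on `(−∞,0)×ℝ³`, divergence
free, KNSS/Oseen-mild between all times `s < t < 0`, `‖u(t,x)‖ ≤ C/√(−t)` — annihilated by the
generator `L_ξ u = ∇u·(a + σx + Ax) + σu + 2σt∂ₜu − Au` of a nonzero `ξ = (a, σ, A)` (`A` skew)
vanishes identically on `t < 0`.

THE LINE (crux idea `Ideas/spiral-weight-killing-pairing.md`, triage r1: 3 × pass-with-doubt).
The idea's lever lives on the SPIRAL leaf `σ ≠ 0` (rotated self-similar elements). After the
kinematic normal form (`stub_spiralNormalForm`: divide `ξ` by `σ`, recentre, rotate the axis of `A`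
onto `e₃` — `𝒜_C` is `Sim(3)`-invariant, same `C`) and the far-field decay upgrade of the sibling
recentring/Oseen-bootstrap line (`stub_spiralTypeIDecay`: space–time Type-I bound, Pineau–Vicol
(1.10)), the element is `u = pvAnsatz β U` for a smooth profile `(U, P)` solving the Pineau–Vicol
profile system (1.8) at rate `β` with the `β`-free decay package (1.9)/(2.1) and bounded `∇P`
(`stub_rssProfileReduction`: ODE integration of `L_ξ u = 0`, gauge pressure, PV Lemma 2.1). On such
profiles the LEVER acts: let `w > 0` be the invariant density of the SPIRALLING Ornstein–Uhlenbeck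
diffusion `dX = −(U + ½X − βJX)dt + √2 dB`, i.e. `Δw + (U + ½y − βJy)·∇w + (3/2)w = 0` with
two-sided Gaussian bounds (`stub_spiralWeightExists` = PV Prop 5.1 with the rotation drift put INSIDE
the operator; the extra drift `βJy` is divergence free, tangent to spheres and kills PV's radial
barriers). Pairing the Bernoulli equation `L_βΠ = −|Ω|² − β∂_θP` AND the `e₃`-angular-momentum
equation `L_β(U·Jy) + 2Ω₃ + ∂_θP = 0` (momentum dotted with the Killing field `Jy`) against `w`
cancels the pressure defect exactly:
  `∫ |Ω|² w dy = 2β ∫ Ω₃ w dy`                                   (`stub_killingPairingIdentity`).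
Completing a square (`0 ≤ ∫ (Ω₃ − 2β)² w`, PROVED below: `enstrophyCeiling_of`; and the chirality
`β∫Ω₃w ≥ 0`, `axialMoment_nonneg_of`) turns it into the ENSTROPHY CEILING `∫|Ω|²w ≤ 4β² ∫w`, and
the line closes the spiral leaf with the weighted
ε-regularity statement "a profile whose `μ_β`-enstrophy is at most `4β²` per unit `μ_β`-mass is
trivial" (`stub_weightedEnstrophyFloor` — THE BET, HARDEST: at `β = 0` it is "`Ω ≡ 0` ⇒ `U ≡ 0`"
(harmonic decaying field), for `|β| < β₁(K)` it is PV Prop 3.1 after a Lebesgue↔`μ_β` conversion,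
for `|β| > β₂(K)` it is PV Thm 1.4(ii), and on the window `β₁ ≤ |β| ≤ β₂` it is Pineau–Vicol
Conjecture 1.1 = Tsai 2018 Conj 8.9, OPEN). The isometric leaves `σ = 0` (translations, screws,
rotations) are NOT this idea's business: since route rev 10 they are the two ROUTE ITEMS
`HelicalEndLiouville` (stmt-14062) and `AxisymEndLiouville` (stmt-14061) at the end `θ = 0`
(`isometricLeaves_of`, PROVED — the route's own `closes` Step 0), which the composition takes as its
only hypotheses, BY NAME (no duplicate obligation is registered here).

`SymmetricLiouville_of (hH : HelicalEndLiouville) (hA : AxisymEndLiouville) : SymmetricLiouville`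
composes the six stubs into the crux BY NAME (kernel-checked; no `sorry` outside the six `stub_*`,
which it invokes): `σ = 0` ↦ `isometricLeaves_of hH hA`; `σ ≠ 0` ↦ normal form → decay → profile →
(`rssProfileLiouville_of`: weight + identity + square + floor ⇒ `U = 0`) → `pvAnsatz β 0 = 0` →
`u ≡ 0`.

## Disproof used (cdisprove `Cruxes/SymmetricLiouville/Disproof.lean` v6, 2026-08-16; landed
`Theorems/SymmetricLiouville/Negative/{AncientLoadBearing,FinerCuts,LoadBearing}` — IMPORTED here:
the stubs are written in the Negative module's own unbundling `InClass` / `IsSkew` / `HasSymmetry` /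
`VanishesOnPast`, `symmetricLiouville_iff := Iff.rfl`)
* `symmetricLiouville_false_without_typeI` / `_with_bounded` / `_false_typeI_near_zero_bounded_past`
  (constant field): HONOURED — every `u`-level stub keeps the full `InClass C u` (Type-I decay on the
  whole past); the line USES the decay at `stub_spiralTypeIDecay` (recentring limits are killed by the
  Type-I rate at `−∞`) and at `stub_rssProfileReduction` ((1.10) ⇒ profile decay (1.9): constants are
  RSS profiles for every `β` — `∇P` affine — and are excluded exactly by `‖U y‖ ≤ K/(1+‖y‖)`).
* `symmetricLiouville_false_without_mild` / `_false_mild_on_window` (parasitic / faded constants):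
  HONOURED — `InClass` keeps the Oseen equation for all `s < t < 0`; USED at
  `stub_rssProfileReduction` (gauge pressure `P = R_iR_j(U_iU_j)`; a parasitic `b(t)` has no profile
  equation with bounded `∇P`… it is not mild) and inside `stub_spiralTypeIDecay` and the two
  Killing-leaf items (the translation leaf F6 is a statement about the mild class).
* `symmetricLiouville_false_on_window` (shear wave `e^{−4π²t} sin(2πy₀)e₁`, translation invariant):
  HONOURED — it concerns the isometric leaf only; `IsometricLeaves` and the two route items are
  statements about ANCIENT elements (`InClass` / `IsTypeIAncientMild` on the whole past), where the
  shear wave is excluded by its growth at `−∞`; no stub is a window statement.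
* Reductions `symmetricLiouville_implies_rss(_decaying)`: CONSISTENT — the profile-level target of this
  line, `RSSProfileLiouville` below, is PV Conj 1.1 for all `β` (incl. `β = 0` = NRS/Tsai) in profile
  variables, i.e. `RotatedSelfSimilarLiouvilleDecaying` after `stub_rssProfileReduction`; the open
  window is named, not hidden (`stub_weightedEnstrophyFloor`).
* `ledger negatives --problem NavierStokesRegularity` (2026-08-16): stmt-4055 (FiniteTangentModuli,
  linearised-moduli count — unrelated to every stub here), stmt-0154 (Clay C non-uniqueness —
  unrelated). No stub is an instance of either.
-/

set_option linter.dupNamespace false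

noncomputable section

namespace Summit.NavierStokesRegularity.NavierStokesRegularity.Cruxes.SymmetricLiouville.SpiralWeightKillingPairing

open MeasureTheory Set
open Literature.Analysis.FluidPDE
open Summit.NavierStokesRegularity.NavierStokesRegularity.Theses.SymmetryModuliCount
  (SymmetricLiouville HelicalEndLiouville AxisymEndLiouville)
open Summit.NavierStokesRegularity.NavierStokesRegularity.Theorems.SymmetricLiouville.Negative
  (InClass IsSkew HasSymmetry VanishesOnPast symmetricLiouville_iff)

/-- Local notation for physical / similarity space `ℝ³ = EuclideanSpace ℝ (Fin 3)`. -/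
local notation "ℝ³" => EuclideanSpace ℝ (Fin 3)

/-! ## Profile-level vocabulary (Pineau–Vicol, arXiv:2607.09619, §1.2, §2, §5)

`rotGen y = J y = (−y₁, y₀, 0)` (tree, `SwirlTransportProofs`) is PV's generator `J` of (1.6);
`rotGenL` is the same map as a continuous linear map; `∂_θ = (Jy)·∇`. -/

/-- **The RSS profile package at rotation rate `α` with constant `K`.** `(U, P)` is a smooth solution
of the Pineau–Vicol profile system (1.8a)–(1.8b),
`α(JU − (Jy·∇)U) + ½U + ½(y·∇)U − ΔU + (U·∇)U + ∇P = 0`, `∇·U = 0`, with the `α`-FREE decay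
package of PV (1.9) and Lemma 2.1 (2.1) — `|U| ≤ K/(1+|y|)`, `|∇U| ≤ K/(1+|y|²)`,
`|∇²U| ≤ K/(1+|y|³)` — and a pressure normalised to `|P| ≤ K(1+|y|)`, `|∇P| ≤ K` (the gradient bound
is read off (1.8a) from the others; PV (2.2) gives even `|P| ≤ C/(1+|y|^{2−σ})` for the gauge
pressure `P = R_iR_j(U_iU_j)`, not required here). Constants (`U ≡ c ≠ 0`, `P` affine) solve (1.8a)
for every `α` and are excluded exactly by the decay clause. -/
def RSSProfile (α K : ℝ) (U : ℝ³ → ℝ³) (P : ℝ³ → ℝ) : Prop :=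
  ContDiff ℝ (⊤ : ℕ∞) U ∧ ContDiff ℝ (⊤ : ℕ∞) P ∧ VectorCalculus.IsDivFree U ∧
  (∀ y, α • (rotGen (U y) - fderiv ℝ U y (rotGen y)) + (1 / 2 : ℝ) • U y
      + (1 / 2 : ℝ) • fderiv ℝ U y y - Laplacian.laplacian U y + fderiv ℝ U y (U y)
      + gradient P y = 0) ∧
  (∀ y, ‖U y‖ ≤ K / (1 + ‖y‖) ∧ ‖fderiv ℝ U y‖ ≤ K / (1 + ‖y‖ ^ 2) ∧
      ‖fderiv ℝ (fderiv ℝ U) y‖ ≤ K / (1 + ‖y‖ ^ 3) ∧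
      |P y| ≤ K * (1 + ‖y‖) ∧ ‖gradient P y‖ ≤ K)

/-- **The spiral Fokker–Planck weight package.** `w` is a `C²`, strictly positive solution of the
ADJOINT equation of the full spiral operator `L_α = −Δ + (U + ½y − αJy)·∇`, i.e. of the stationary
Fokker–Planck equation `Δw + (U + ½y − αJy)·∇w + (3/2)w = 0` of the diffusion
`dX = −(U(X) + ½X − αJX)dt + √2 dB` (`∇·(U + ½y − αJy) = 3/2`; PV Remark 5.2 with the rotation drift
added), with two-sided Gaussian bounds of PV (5.3)-type and a Gaussian bound on `∇w` (PV footnote 16):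
`m e^{−|y|²/2} ≤ w ≤ M e^{−|y|²/8}`, `|∇w| ≤ M e^{−|y|²/16}`. For `U ≡ 0` the Gaussian
`e^{−|y|²/4}` is such a weight for EVERY `α` (`Jy·y = 0`). -/
def SpiralWeight (α : ℝ) (U : ℝ³ → ℝ³) (w : ℝ³ → ℝ) (m M : ℝ) : Prop :=
  0 < m ∧ ContDiff ℝ 2 w ∧ (∀ y, 0 < w y) ∧
  (∀ y, Laplacian.laplacian w y + fderiv ℝ w y (U y + (1 / 2 : ℝ) • y - α • rotGen y)
      + (3 / 2 : ℝ) * w y = 0) ∧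
  (∀ y, m * Real.exp (-‖y‖ ^ 2 / 2) ≤ w y ∧ w y ≤ M * Real.exp (-‖y‖ ^ 2 / 8) ∧
      ‖fderiv ℝ w y‖ ≤ M * Real.exp (-‖y‖ ^ 2 / 16))

/-- **Profile-level target of the line** (Pineau–Vicol Conjecture 1.1 in profile variables, for ALL
rates, `α = 0` included = Nečas–Růžička–Šverák / Tsai): a profile in the package is zero. The line
derives it from weight + identity + floor (`rssProfileLiouville_of`). -/
def RSSProfileLiouville : Prop :=
  ∀ (α K : ℝ) (U : ℝ³ → ℝ³) (P : ℝ³ → ℝ), RSSProfile α K U P → U = 0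

/-- **The spiral leaf of the crux at the level of `𝒜_C`** (centred normal form): an element of `𝒜_C`
annihilated by `L_{(0,1,αJ)}` — a backward rotated self-similar field with BOUNDED profile, rotation
about `e₃` — vanishes. A specialisation of the crux (`spiralLeaf_of_symmetricLiouville`); the line
proves it from stubs 2–6 (`spiralLeaf_of`). -/
def SpiralLeaf : Prop :=
  ∀ (C : ℝ) (u : ℝ → ℝ³ → ℝ³) (α : ℝ), InClass C u → HasSymmetry u 0 1 (α • rotGenL) →
    VanishesOnPast u

/-! ## The isometric leaves (route items) and the six stub statements -/

/-- **The isometric leaves (`σ = 0`: translations, screw motions, rotations) — NOT a stub of this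
line.** An element of `𝒜_C` annihilated by `L_{(a,0,A)}`, `(a, A) ≠ (0, 0)`, `A` skew, vanishes. This
is other seats' business and is, since route rev 10, literally the conjunction of two ROUTE ITEMS at the
end `θ = 0`: `HelicalEndLiouville` (stmt-NavierStokesRegularity-14062: `a ∉ range A` — translation or
nonzero pitch; blow-down kills the pitch + ε-Liouville at `−∞`) and `AxisymEndLiouville`
(stmt-NavierStokesRegularity-14061: `a ∈ range A` — recentre to a pure rotation; C/r law + KNSS 5.3),
see `isometricLeaves_of` (PROVED, the route's own `closes` Step 0 at `θ = 0`). The composition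
`SymmetricLiouville_of` therefore takes those two items as its only hypotheses, BY NAME. -/
def IsometricLeaves : Prop :=
  ∀ (C : ℝ) (u : ℝ → ℝ³ → ℝ³) (a : ℝ³) (A : ℝ³ →L[ℝ] ℝ³), InClass C u → IsSkew A →
    ¬ (a = 0 ∧ A = 0) → HasSymmetry u a 0 A → VanishesOnPast u

/-- **Stub 1 — spiral normal form (kinematics + `Sim(3)`-covariance of the gauge class).** If
`σ ≠ 0`, divide `ξ` by `σ` (the generator is linear in `ξ`), translate by `c = −(1 + A/σ)⁻¹(a/σ)`
(`1 + A/σ` is invertible, `A/σ` skew) and rotate coordinates by `R ∈ SO(3)` taking the axis of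
`A/σ` to `e₃` (a skew map of `ℝ³` is `x ↦ ω × x`; `Rᵀ(A/σ)R = αJ`, `α = ±|ω|/σ`): the conjugated
field `v(t,x) = Rᵀu(t, Rx + c)` is again in `𝒜_C` with the SAME `C` (heat flow and the Oseen kernel
are `O(3)`- and translation-covariant: `K(τ,Rz)[Ra,Rb] = RK(τ,z)[a,b]`, the kernel being built from
`⟪z,·⟫`, `z` and radial weights), it is annihilated by `L_{(0,1,αJ)}`, and `v ≡ 0 ⇒ u ≡ 0`. -/
def SpiralNormalForm : Prop :=
  ∀ (C : ℝ) (u : ℝ → ℝ³ → ℝ³) (a : ℝ³) (σ : ℝ) (A : ℝ³ →L[ℝ] ℝ³), InClass C u → IsSkew A →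
    σ ≠ 0 → HasSymmetry u a σ A →
    ∃ (α : ℝ) (v : ℝ → ℝ³ → ℝ³), InClass C v ∧ HasSymmetry v 0 1 (α • rotGenL) ∧
      (VanishesOnPast v → VanishesOnPast u)

/-- **Stub 2 — far-field decay of spiral-symmetric elements (IMPORTED from the sibling
recentring/Oseen-bootstrap line; = `SpiralScalingTypeIDecay` of `SketchIdeator1`, B1+B2 of
farfield-recentring-critical-rate ≈ Lemma A/B of stabiliser-at-infinity-decay).** A centred
spiral-scaling-symmetric element of `𝒜_C` obeys the SPACE–TIME Type-I bound
`‖u(t,x)‖ ≤ C'/(‖x‖ + √(−t))` (PV (1.10) ⇔ profile decay (1.9)): recentring at far points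
degenerates the stabiliser to a translation, the recentred limits are translation-invariant
elements of `𝒜_C` hence `0` (leaf T, decay at `−∞` used), so `√(−t)|u| → 0` as `|x|/√(−t) → ∞`;
the global Oseen identity then bootstraps `o(1)` to `K√(−t)/|x|` (master inequality
`m(L) ≤ K₁m(L/4)² + (K₂/L)∫₀ᴸm²`, no log loss — triage r1-1 S6, r1-2 §C, r1-3). -/
def SpiralTypeIDecay : Prop :=
  ∀ (C : ℝ) (u : ℝ → ℝ³ → ℝ³) (α : ℝ), InClass C u → HasSymmetry u 0 1 (α • rotGenL) →
    ∃ C' : ℝ, HasTypeIDecay C' u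

/-- **Stub 3 — reduction to a Pineau–Vicol profile (ODE integration of the symmetry + gauge
pressure + PV Lemma 2.1).** For `u ∈ 𝒜_C` with `L_{(0,1,αJ)}u = 0` and the space–time bound:
(i) integrating `∇u·(x + αJx) + u + 2t∂ₜu − αJu = 0` along the complete flow
`(t,x) ↦ (e^{2s}t, e^{s}e^{αsJ}x)` of `t < 0` gives `u(t,x) = (−t)^{−1/2}R(βs)U(R(−βs)x/√(−t))`,
`s = −log(−t)`, `U = u(−1,·)`, `β = −α/2`, i.e. `u = pvAnsatz β U` on `t < 0`; (ii) smooth +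
KNSS-mild ⇒ classical Navier–Stokes with the gauge pressure `p = R_iR_j(u_iu_j)` (tree bridge
`exists_isClassicalNSSolutionOn_of_smooth_isMildNSSolutionOn` after identifying the crux's double
Oseen integral with `oseenDuhamel`), and `P := p(−1,·)` turns NS at `t = −1` into (1.8a)–(1.8b)
(PV §1.2); (iii) (1.10) at `t = −1` is (1.9) with `K = C'`; the tree's uniform local smoothing
(`knss2009_local_smoothing_holds`) on the parabolic cylinders of PV's proof of Lemma 2.1 gives (2.1),
and `∇P` is bounded by (1.8a) (every other term is). The rate `β` is existential (no sign convention
is load-bearing). -/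
def RSSProfileReduction : Prop :=
  ∀ (C C' : ℝ) (u : ℝ → ℝ³ → ℝ³) (α : ℝ), InClass C u → HasSymmetry u 0 1 (α • rotGenL) →
    HasTypeIDecay C' u →
    ∃ (β K : ℝ) (U : ℝ³ → ℝ³) (P : ℝ³ → ℝ), RSSProfile β K U P ∧
      ∀ t < 0, ∀ x, u t x = pvAnsatz β (fun y _ => U y) t x

/-- **Stub 4 — existence of the spiral Fokker–Planck weight (S1 of the idea card; PV Prop 5.1 with
the rotation drift INSIDE the operator).** For smooth divergence-free `U` with (1.9)/(2.1) and every
`α` there is a `C²` weight `w > 0` with `Δw + (U + ½y − αJy)·∇w + (3/2)w = 0` and Gaussian bounds.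
PV's proof (principal Dirichlet eigenpairs on `B_R`, `λ_R ↓ 0`, radial Gaussian barriers, Harnack,
`C²_loc` compactness; Lemmas 5.3–5.6) goes through because `αJy` is divergence free, tangent to
spheres (`Jy·∇φ(|y|) = 0` for the radial barriers and for the Lyapunov function `|y|²`) and smooth;
the gradient bound is interior elliptic regularity on balls of radius `(1+|y|)⁻¹` (drift
`O((1+|α|)(1+|y|))`) absorbed into the Gaussian. `m, M` may depend on `α` (existential). -/
def SpiralWeightExists : Prop :=
  ∀ (α K : ℝ) (U : ℝ³ → ℝ³), ContDiff ℝ (⊤ : ℕ∞) U → VectorCalculus.IsDivFree U →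
    (∀ y, ‖U y‖ ≤ K / (1 + ‖y‖) ∧ ‖fderiv ℝ U y‖ ≤ K / (1 + ‖y‖ ^ 2) ∧
      ‖fderiv ℝ (fderiv ℝ U) y‖ ≤ K / (1 + ‖y‖ ^ 3)) →
    ∃ (w : ℝ³ → ℝ) (m M : ℝ), SpiralWeight α U w m M

/-- **Stub 5 — THE LEVER: the Killing-pairing identity `∫|Ω|²w = 2α∫Ω₃w`** (with the
integrability by-products the composition consumes). Pointwise, for a profile in the package
(`Π = P + ½|U|² + ½y·U`, `m₃ = U·Jy`, `L_α = −Δ + (U + ½y − αJy)·∇`, `Ω = curl U`,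
`Ω₃ = ∂₀U₁ − ∂₁U₀ = (curl U) 2`): `L_αΠ + |Ω|² + α∂_θP = 0` (PV (4.3) with (4.6): `∂_θΠ = ∂_θP + E`)
and `L_αm₃ + 2Ω₃ + ∂_θP = 0` ((1.8a)·Jy, using `JU·Jy = ∂_θU·Jy − ∂_θm₃`, `(y·∇U)·Jy = y·∇m₃ − m₃`,
`ΔU·Jy = Δm₃ − 2Ω₃`, `(U·∇U)·Jy = U·∇m₃`) — both machine-checked symbolically (kit j009045,
j010063 T3, j010108 I1–I2) and by hand by all three triagers. Pairing each against `w`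
(`∫(L_αf)w = ∫f·L_α^*w = 0` for `f = Π, m₃`: two integrations by parts on `B_R`, `R → ∞`, boundary
terms killed by the Gaussian bounds on `w, ∇w` against the polynomial bounds on `Π, ∇Π, m₃, ∇m₃`
from the package) and `∫(∂_θP)w = −∫P∂_θw` gives `∫|Ω|²w = −α∫(∂_θP)w = 2α∫Ω₃w`. At `α = 0` it is
PV (1.5)/(5.4): `∫|Ω|²w = 0`. -/
def KillingPairingIdentity : Prop :=
  ∀ (α K : ℝ) (U : ℝ³ → ℝ³) (P : ℝ³ → ℝ) (w : ℝ³ → ℝ) (m M : ℝ),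
    RSSProfile α K U P → SpiralWeight α U w m M →
    Integrable w ∧ Integrable (fun y => ‖curl U y‖ ^ 2 * w y) ∧
    Integrable (fun y => (curl U y) 2 * w y) ∧ Integrable (fun y => (curl U y) 2 ^ 2 * w y) ∧
    (∫ y, ‖curl U y‖ ^ 2 * w y) = 2 * α * (∫ y, (curl U y) 2 * w y)

/-- **Stub 6 — THE BET (hardest): weighted small-enstrophy Liouville at threshold `4α²`.** A
profile in the package whose enstrophy in the invariant measure `μ_α = w dy` is at most `4α²` per
unit `μ_α`-mass is trivial. Regimes: `α = 0` — the hypothesis says `∫|Ω|²w ≤ 0`, so `Ω ≡ 0`, `U` is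
harmonic and decays, `U ≡ 0` (KNOWN, S); `|α| < α₁(K, m, M)` — `‖Ω‖²_{L²(B_R̄)} ≤ e^{R̄²/2}m⁻¹∫|Ω|²w
≤ 4α²e^{R̄²/2}M'/m < C_Ω⁻²` and PV Prop 3.1 (`R̄ = √(8K)`, `C_Ω` universal, `∇Ω ∈ L²` by (2.1))
gives `U ≡ 0` (KNOWN modulo formalising Prop 3.1, M–L); `|α| > α₂(K)` — equivalent to PV Thm 1.4(ii)
(§6, `RU` small; XL or conditional on the named fact `pineauVicol2026_rss_liouville`); the WINDOW
`α₁ ≤ |α| ≤ α₂` — Pineau–Vicol Conjecture 1.1 = Tsai 2018 Conj 8.9 (Perelman), OPEN: this is where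
`EnergySupercriticality` bites (every identity here is quadratic with one factor frozen into `w`).
Why it might be attackable in this form: the unknown is an ε-regularity statement in a probability
measure with Gaussian tails adapted to the drift, for which Poincaré/Lyapunov tools for non-gradient
diffusions exist; no claim that they suffice. -/
def WeightedEnstrophyFloor : Prop :=
  ∀ (α K : ℝ) (U : ℝ³ → ℝ³) (P : ℝ³ → ℝ) (w : ℝ³ → ℝ) (m M : ℝ),
    RSSProfile α K U P → SpiralWeight α U w m M →
    ((∫ y, ‖curl U y‖ ^ 2 * w y) ≤ 4 * α ^ 2 * (∫ y, w y)) → U = 0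

/-! ## The registered stubs -/

/-- Stub 1 (`SpiralNormalForm`; M, kinematic). Why it might fail: it does not (linear algebra of
`sim(3)` + covariance of the explicit Oseen kernel); formal debt = change of variables in the Bochner
integrals and the chain rule for `fderiv`/`timeDeriv` under `x ↦ Rx + c`. -/
theorem stub_spiralNormalForm : SpiralNormalForm := by
  sorry

/-- Stub 2 (`SpiralTypeIDecay`; L, IMPORTED — the recentring line's theorem). Why it might fail: a
log loss in the Oseen bootstrap would leave `K√(−t)log(|x|/√(−t))/|x|` (triage checked the master
inequality region by region: no log); the recentring step needs 𝒜_C compactness F3 + leaf T. -/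
theorem stub_spiralTypeIDecay : SpiralTypeIDecay := by
  sorry

/-- Stub 3 (`RSSProfileReduction`; M–L, KNOWN in print: PV §1.2 + Lemma 2.1). Why it might fail: it
does not at truth level; formal debt = uniform local smoothing on far cylinders (tree
`knss2009_local_smoothing_holds`) and the mild ⇒ classical-with-gauge-pressure bridge. -/
theorem stub_rssProfileReduction : RSSProfileReduction := by
  sorry

/-- Stub 4 (`SpiralWeightExists`; M–L, PV Prop 5.1 mutatis mutandis). Why it might fail: the only
`α`-sensitive step is the interior gradient estimate (drift `αJy` unbounded) — absorbed by shrinking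
balls; all barrier computations are literally PV's (radial barriers do not see `Jy`). -/
theorem stub_spiralWeightExists : SpiralWeightExists := by
  sorry

/-- Stub 5 (`KillingPairingIdentity`; M — THE LEVER). Why it might fail: a sign error (excluded: three
independent hand derivations + three sympy jobs); formal debt = two whole-space integrations by parts
with Gaussian tails (tree `WholeSpaceIBP`) and the pointwise identities over `fderiv`/`curl`/`rotGen`. -/
theorem stub_killingPairingIdentity : KillingPairingIdentity := by
  sorry

/-- Stub 6 (`WeightedEnstrophyFloor`; XL, OPEN on the window — THE BET, HARDEST; the lead holds this
one or parks the line on it). Why it might fail: a nontrivial RSS profile at `α ≈ 1` whose vorticity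
sits at `|y| ~ R̄(K)` where `w` is `e^{−O(K²)}`-small satisfies the ceiling with room to spare; nothing
in the finite system of exact moment identities is known to forbid it. -/
theorem stub_weightedEnstrophyFloor : WeightedEnstrophyFloor := by
  sorry

/-! ## Consequences of the lever alone (PROVED from stub 5): ceiling and chirality -/

/-- **Enstrophy ceiling** (idea card, consequence (a)): for a profile in the package and a spiral
weight, `∫|Ω|²w ≤ 4α² ∫w` — from the identity by completing a square in the axial component:
`0 ≤ ∫(Ω₃ − 2α)²w = ∫Ω₃²w − 4α∫Ω₃w + 4α²∫w ≤ ∫|Ω|²w − 2∫|Ω|²w + 4α²∫w`. With PV Prop 3.1 and the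
lower Gaussian bound on `w` this re-proves the small-`|α|` half of PV Thm 1.4 (the regime where
stub 6 is known). -/
theorem enstrophyCeiling_of (hI : KillingPairingIdentity) (α K : ℝ) (U : ℝ³ → ℝ³) (P : ℝ³ → ℝ)
    (w : ℝ³ → ℝ) (m M : ℝ) (hprof : RSSProfile α K U P) (hw : SpiralWeight α U w m M) :
    (∫ y, ‖curl U y‖ ^ 2 * w y) ≤ 4 * α ^ 2 * (∫ y, w y) := by
  obtain ⟨hIw, hIΩ, hI3, hI33, hid⟩ := hI α K U P w m M hprof hw
  have hwpos : ∀ y, 0 < w y := hw.2.2.1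
  -- (a) the axial component carries at most the whole enstrophy
  have hA3X : (∫ y, (curl U y) 2 ^ 2 * w y) ≤ ∫ y, ‖curl U y‖ ^ 2 * w y := by
    refine integral_mono hI33 hIΩ fun y => ?_
    have h1 : |(curl U y) 2| ≤ ‖curl U y‖ := by
      simpa [Real.norm_eq_abs] using PiLp.norm_apply_le (curl U y) 2
    have h2 : (curl U y) 2 ^ 2 ≤ ‖curl U y‖ ^ 2 :=
      calc (curl U y) 2 ^ 2 = |(curl U y) 2| ^ 2 := (sq_abs _).symm
        _ ≤ ‖curl U y‖ ^ 2 := pow_le_pow_left₀ (abs_nonneg _) h1 2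
    exact mul_le_mul_of_nonneg_right h2 (hwpos y).le
  -- (b) the completed square is nonnegative …
  have hnonneg : 0 ≤ ∫ y, ((curl U y) 2 - 2 * α) ^ 2 * w y :=
    integral_nonneg fun y => mul_nonneg (sq_nonneg _) (hwpos y).le
  -- (c) … and expands linearly (all three pieces are integrable, stub 5)
  have hexp : (∫ y, ((curl U y) 2 - 2 * α) ^ 2 * w y) =
      (∫ y, (curl U y) 2 ^ 2 * w y) - 4 * α * (∫ y, (curl U y) 2 * w y)
        + 4 * α ^ 2 * (∫ y, w y) := by
    have hpt : (fun y => ((curl U y) 2 - 2 * α) ^ 2 * w y) =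
        fun y => ((curl U y) 2 ^ 2 * w y - (4 * α) * ((curl U y) 2 * w y))
          + (4 * α ^ 2) * w y := by
      funext y; ring
    have hI4 : Integrable (fun y => 4 * α * ((curl U y) 2 * w y)) := hI3.const_mul (4 * α)
    have hI1 : Integrable (fun y => (curl U y) 2 ^ 2 * w y - 4 * α * ((curl U y) 2 * w y)) :=
      hI33.sub hI4
    have hI2 : Integrable (fun y => 4 * α ^ 2 * w y) := hIw.const_mul (4 * α ^ 2)
    rw [hpt, integral_add hI1 hI2, integral_sub hI33 hI4, integral_const_mul, integral_const_mul]
  -- (d) combine with the identity `∫|Ω|²w = 2α∫Ω₃w`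
  have key : 4 * α ^ 2 * (∫ y, w y) - (∫ y, ‖curl U y‖ ^ 2 * w y) =
      (∫ y, ((curl U y) 2 - 2 * α) ^ 2 * w y)
        + ((∫ y, ‖curl U y‖ ^ 2 * w y) - ∫ y, (curl U y) 2 ^ 2 * w y) := by
    rw [hexp]
    linear_combination (-2 : ℝ) * hid
  have hfin : 0 ≤ 4 * α ^ 2 * (∫ y, w y) - (∫ y, ‖curl U y‖ ^ 2 * w y) := by
    rw [key]
    exact add_nonneg hnonneg (sub_nonneg.mpr hA3X)
  exact sub_nonneg.mp hfin

/-- **Chirality** (idea card, consequence (b), weak form): the `w`-mean AXIAL vorticity of a profile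
co-rotates with the pattern, `α ∫Ω₃w = ½∫|Ω|²w ≥ 0` — a checkable necessary condition on any
numerical `α ≈ 1` profile (for the disprover: an anti-cyclonic core is impossible). -/
theorem axialMoment_nonneg_of (hI : KillingPairingIdentity) (α K : ℝ) (U : ℝ³ → ℝ³) (P : ℝ³ → ℝ)
    (w : ℝ³ → ℝ) (m M : ℝ) (hprof : RSSProfile α K U P) (hw : SpiralWeight α U w m M) :
    0 ≤ α * (∫ y, (curl U y) 2 * w y) := by
  obtain ⟨-, -, -, -, hid⟩ := hI α K U P w m M hprof hw
  have hwpos : ∀ y, 0 < w y := hw.2.2.1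
  have hX : 0 ≤ ∫ y, ‖curl U y‖ ^ 2 * w y :=
    integral_nonneg fun y => mul_nonneg (sq_nonneg _) (hwpos y).le
  have h : α * (∫ y, (curl U y) 2 * w y) = (∫ y, ‖curl U y‖ ^ 2 * w y) / 2 := by
    linear_combination (-1 / 2 : ℝ) * hid
  rw [h]
  exact div_nonneg hX zero_le_two

/-! ## Glue (PROVED): weight + ceiling + floor ⇒ profile Liouville ⇒ spiral leaf -/

/-- **The spiral leaf at profile level.** From the weight (stub 4), the Killing-pairing identity
(stub 5, through `enstrophyCeiling_of`) and the weighted ε-regularity floor (stub 6): every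
profile in the package vanishes. -/
theorem rssProfileLiouville_of (hW : SpiralWeightExists) (hI : KillingPairingIdentity)
    (hF : WeightedEnstrophyFloor) : RSSProfileLiouville := by
  intro α K U P hprof
  obtain ⟨hUs, hPs, hdiv, hEq, hdec⟩ := hprof
  have hprof' : RSSProfile α K U P := ⟨hUs, hPs, hdiv, hEq, hdec⟩
  obtain ⟨w, m, M, hw⟩ :=
    hW α K U hUs hdiv (fun y => ⟨(hdec y).1, (hdec y).2.1, (hdec y).2.2.1⟩)
  exact hF α K U P w m M hprof' hw (enstrophyCeiling_of hI α K U P w m M hprof' hw)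

/-- **The spiral leaf at the level of `𝒜_C`.** A centred spiral-scaling-symmetric element of `𝒜_C`
vanishes: decay (stub 2) → profile (stub 3) → profile Liouville → the ansatz of the zero profile is
zero. -/
theorem spiralLeaf_of (hD : SpiralTypeIDecay) (hR : RSSProfileReduction)
    (hL : RSSProfileLiouville) : SpiralLeaf := by
  intro C u α hu hsym
  obtain ⟨C', hdec⟩ := hD C u α hu hsym
  obtain ⟨β, K, U, P, hprof, hans⟩ := hR C C' u α hu hsym hdec
  have hU : U = 0 := hL β K U P hprof
  subst hU
  intro t ht x
  rw [hans t ht x]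
  have h0 : ∀ θ : ℝ, rotZ θ (0 : ℝ³) = 0 := fun θ => by
    have h := norm_rotZ θ (0 : ℝ³)
    rw [norm_zero] at h
    exact norm_eq_zero.mp h
  simp [pvAnsatz, h0]

/-! ## The isometric leaves from the route's Killing-leaf items (PROVED) -/

/-- **Isometric leaves ⟸ `HelicalEndLiouville` ∧ `AxisymEndLiouville` at `θ = 0`** (the route's
`closes`, Step 0, verbatim in content): split on whether the translation part `a` lies in the range of
the rotation part `A`; if `a = A c'`, recentre at `−c'` (`A(x + c') = a + Ax`) and use the axisymmetric
item, else the helical/periodic item. `InClass` ↔ `IsTypeIAncientMild` is `isTypeIAncientMild_iff`. -/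
theorem isometricLeaves_of (hH : HelicalEndLiouville) (hA : AxisymEndLiouville) :
    IsometricLeaves := by
  intro C u a A hu hAs hne hsym
  have hu' : IsTypeIAncientMild C u := isTypeIAncientMild_iff.2 hu
  have hsym' : ∀ t < (0 : ℝ), ∀ x, fderiv ℝ (u t) x (a + A x) - A (u t x) = 0 := by
    intro t ht x
    have := hsym t ht x
    simpa using this
  by_cases hr : a ∈ Set.range A
  · obtain ⟨c', hc'⟩ := hr
    have hA0 : A ≠ 0 := by
      rintro rfl
      exact hne ⟨by simpa using hc'.symm, rfl⟩
    refine hA C u hu' (-c') A 0 hAs hA0 le_rfl ?_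
    intro t ht x
    have key := hsym' t ht x
    have e : A (x - -c') = a + A x := by
      rw [map_sub, map_neg, hc']; abel
    rw [e]
    exact key
  · exact hH C u hu' a A 0 hAs hr le_rfl hsym'

/-! ## Sanity (PROVED): calibration of the stubs against the crux and against each other -/

/-- The isometric leaves are a SPECIALISATION of the crux (`σ = 0`): the two route items used by
`SymmetricLiouville_of` are asked only for what the crux itself asserts there. -/
theorem isometricLeaves_of_symmetricLiouville (h : SymmetricLiouville) : IsometricLeaves := by
  rw [symmetricLiouville_iff] at h
  intro C u a A hu hA hne hsym
  exact h C u hu a 0 A hA (fun hz => hne ⟨hz.1, hz.2.2⟩) hsym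

/-- The spiral leaf is a SPECIALISATION of the crux (`a = 0`, `σ = 1`, `A = αJ`, which is skew:
`⟪αJx, x⟫ = 0`). With `isometricLeaves_of_symmetricLiouville` and `SymmetricLiouville_of`: modulo the
kinematic stub 1, the crux is EQUIVALENT to `IsometricLeaves ∧ SpiralLeaf`. -/
theorem spiralLeaf_of_symmetricLiouville (h : SymmetricLiouville) : SpiralLeaf := by
  rw [symmetricLiouville_iff] at h
  intro C u α hu hsym
  refine h C u hu 0 1 (α • rotGenL) (fun x => ?_) (fun hz => one_ne_zero hz.2.1) hsym
  show inner ℝ (α • rotGen x) x = 0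
  rw [real_inner_smul_left, inner_rotGen_self, mul_zero]

/-- HONESTY LEMMA (triage r1-2): given the weight and the identity, stub 6 is not merely sufficient
but EQUIVALENT to the profile-level Liouville statement — `RSSProfileLiouville → WeightedEnstrophyFloor`
trivially (this direction) and `rssProfileLiouville_of` (the other). The lever RELOCATES the spiral
leaf to a weighted ε-regularity statement; it does not by itself close the window. -/
theorem weightedEnstrophyFloor_of_rssProfileLiouville (h : RSSProfileLiouville) :
    WeightedEnstrophyFloor :=
  fun α K U P _ _ _ hprof _ _ => h α K U P hprof

/-! ## The crux from the line -/

/-- **The crux from the line** — the ONLY theorem of this file concluding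
`Summit.NavierStokesRegularity.NavierStokesRegularity.Theses.SymmetryModuliCount.SymmetricLiouville`,
BY NAME; its only hypotheses are the two ROUTE ITEMS `HelicalEndLiouville`, `AxisymEndLiouville`
(by name), the six registered stubs are INVOKED (sorries live only in `stub_*`; everything else is
kernel-closed). `σ = 0`: `isometricLeaves_of`. `σ ≠ 0`: stub 1 (normal form) → `spiralLeaf_of`
(stubs 2, 3 and `rssProfileLiouville_of` = stubs 4, 5, 6 + the completed square). -/
theorem SymmetricLiouville_of (hH : HelicalEndLiouville) (hA : AxisymEndLiouville) :
    SymmetricLiouville := by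
  rw [symmetricLiouville_iff]
  intro C u hu a σ A hAs hne hsym
  by_cases hσ : σ = 0
  · subst hσ
    exact isometricLeaves_of hH hA C u a A hu hAs (fun h => hne ⟨h.1, rfl, h.2⟩) hsym
  · obtain ⟨α, v, hv, hsymv, hback⟩ := stub_spiralNormalForm C u a σ A hu hAs hσ hsym
    exact hback (spiralLeaf_of stub_spiralTypeIDecay stub_rssProfileReduction
      (rssProfileLiouville_of stub_spiralWeightExists stub_killingPairingIdentity
        stub_weightedEnstrophyFloor) C v α hv hsymv)

end Summit.NavierStokesRegularity.NavierStokesRegularity.Cruxes.SymmetricLiouville.SpiralWeightKillingPairing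

end
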